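import Literature.NumberTheory.ComplexMultiplication.FiniteQAlgebraLatticeExactIdealClassesFinite
import Literature.NumberTheory.ComplexMultiplication.FiniteQAlgebraLatticeClassGroupBijections
import HarnessLib

/-!
# Hertling–Larabi 2026 THEOREM 1.3 (b) ∕ 2026b REMARKS 5.6 (i): the finitely many `ε`-classes of exact `Λ`-ideals
# split into finitely many `w`-classes, all of the size of the group `G([Λ]_ε)` — the counting formula
# `#{[L]_ε | 𝒪(L) = Λ} = #{[L]_w | 𝒪(L) = Λ} · |G([Λ]_ε)|`

[topic NumberTheory/ComplexMultiplication] General-`A` series (namespace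
`Literature.NumberTheory.ComplexMultiplication.FiniteQAlgebraLattice`); sequel of
`FiniteQAlgebraLatticeExactIdealClassesFinite` (Thm. 6.5 = Thm. 1.3 (a): `{[L]_ε | 𝒪(L) = Λ}` is finite for every
`A`) and `FiniteQAlgebraLatticeClassGroupBijections` (Thm. 5.8 (b) (5.13): each `w`-class of `ε`-classes is in
bijection with `G([𝒪(L_1)]_ε)`; Rem. 9.3 (iv)).  Lane `lit-hodgefound` (Track 2 foundations library), seat p19
generation 38, row g38-#3.  THEOREMS ONLY: no definition, no instance, no notation, no named fact (D-0026, net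
Literature debt `0`), no `sorry`.

DEF-FREE SPELLING (as in the files above).  The `ε`-classes over `Λ` are the quotient TYPE of
`{L // IsFullLattice A L ∧ L / L = Λ}` by `L ∼ uL` (`u ∈ A^{unit}`); the `w`-classes over `Λ` are the quotient of the
same subtype by `L ∼_w L' :⟺ 1 ∈ (L:L')(L':L)` (Thm. 5.7 (a) (i) ⟺ (ii), `FiniteQAlgebraLatticeWeakEquivalence`);
`G([Λ]_ε)` is the quotient of `{L // IsFullLattice A L ∧ L / L = Λ ∧ L((L:L):L) = L:L}`; «size» is `Nat.card`.  The
projection `[L]_ε ↦ [L]_w` is any map `f` between the first two quotients with `f [L]_ε = [L]_w` (it exists: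
`exists_quotMap_weak`).

## Sources, VERBATIM

C. Hertling, K. Larabi, *Semigroups from full lattices in commutative ℚ-algebras*, arXiv:2602.14973 (2026)
[HertlingLarabi2026], held `paper:arxiv-2602.14973`, §1 Thm. 1.3 (chunk p0003): «(a) (Theorem (t6.3) [the source's label; = Theorem 6.5 of §6]) For
each order `Λ` the set `{[L]_ε | L ∈ 𝓛(A), 𝒪(L) = Λ} ⊂ 𝓔(A)` is finite. (b) (Theorem 5.8 (b)) For each order `Λ` the
set `{[L]_ε | L ∈ 𝓛(A), 𝒪(L) = Λ}` splits into finitely many `w`-classes, which have all the same (finite by part (a))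
size. One of them is the group `G([Λ]_ε)`.» and (chunk p0004) «Part (b) is new.»; §5 Thm. 5.8 (b) (chunk p0013):
«Let `Λ` be an order and `L_1 ∈ 𝓛(A)` with `𝒪(L_1) = Λ`. Then `G(Λ) = [Λ]_w` and `G([Λ]_ε) = [[Λ]_ε]_w` (5.11). The
maps `G(Λ) → [L_1]_w, L_3 ↦ L_3L_1` (5.12), `G([Λ]_ε) → [[L_1]_ε]_w, [L_3]_ε ↦ [L_3]_ε[L_1]_ε` (5.13), are well
defined and bijections.»; §5 Thm. 5.7 (chunk p0013): «(a) […] (i) `L_1 ∼_w L_2`. (ii) `1_A ∈ (L_1:L_2)(L_2:L_1)`.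
(iii) `𝒪(L_1) = 𝒪(L_2)` and […] (c) `W(𝓛(A)) = W(𝓔(A))`».

C. Hertling, K. Larabi, *Conjugacy classes of regular integer matrices*, arXiv:2602.15748 (2026)
[HertlingLarabi2026b], held `paper:arxiv-2602.15748`, §5 Remarks 5.6 (chunk p0009): «(i) Let `Λ` be an order. By
(5.3) the finite set `{[L]_ε | L ∈ 𝓛(A), 𝒪(L) = Λ}` splits into finitely many `w`-classes. One of them is the (thus
finite) group `G([Λ]_ε)`. These `w`-classes have all the same size, because (5.3) gives bijections from the finite
group `G([Λ]_ε)` to any other `w`-class in the finite set `{[L]_ε | L ∈ 𝓛(A), 𝒪(L) = Λ}`.»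

## What is proved (`A` any commutative ring with `ℚ ⊆ A`; finiteness statements for `A` finite-dimensional)

* §1 `exists_quotMap_weak` — the projection `[L]_ε ↦ [L]_w` exists and is surjective (Thm. 5.7 (c), `ε ⟹ w`);
  **`finite_quot_weak_div_self_eq` — the `w`-classes over `Λ` are FINITELY MANY** («splits into finitely many
  `w`-classes»; from Thm. 6.5).
* §2 `natCard_fibre_eq_natCard_quot_weak` — the fibre of the projection over `[L_1]_w` has the size of
  `[[L_1]_ε]_w = {[L_2]_ε | L_2 ∼_w L_1}` (`𝒪(L_2) = 𝒪(L_1)` is automatic, Thm. 5.7 (a));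
  **`natCard_fibre_eq_natCard_quot_invertible` — every `w`-class of `ε`-classes over `Λ` has `|G([Λ]_ε)|`
  elements** («These `w`-classes have all the same size», by (5.13)).
* §3 **`natCard_quot_div_self_eq_eq_mul` — THEOREM 1.3 (b) as a COUNTING FORMULA:
  `#{[L]_ε | 𝒪(L) = Λ} = #{[L]_w | 𝒪(L) = Λ} · |G([Λ]_ε)|`** (the `ε`-classes are the disjoint union of the fibres,
  `Equiv.sigmaFiberEquiv`); `natCard_quot_invertible_dvd_natCard_quot_div_self_eq` (`|G([Λ]_ε)|` divides the
  number of `ε`-classes over `Λ`), `natCard_quot_weak_le_natCard_quot_div_self_eq`,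
  `natCard_quot_div_self_eq_eq_of_natCard_quot_weak_eq_one`.
NOT here: HL 2026 Thm. 1.3 (c)–(e) (in the tree: `FiniteQAlgebraLatticePicardExtensionSurjective`,
`FiniteQAlgebraLatticeClassGroupBijections`, `FiniteQAlgebraLatticePowersInvertible`).

## References

* [HertlingLarabi2026] C. Hertling, K. Larabi, arXiv:2602.14973 (2026), §1 Thm. 1.3 (a)(b) (chunks p0003–p0004),
  §5 Thm. 5.7 (a)(c), Thm. 5.8 (b) (5.11)–(5.13) (chunk p0013), §6 Thm. 6.5 (chunk p0015).
  [cite: HertlingLarabi2026, §1 Thm. 1.3 (b), chunk p0003]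
* [HertlingLarabi2026b] C. Hertling, K. Larabi, arXiv:2602.15748 (2026), §5 Thm. 5.5 (d) (5.3), Rem. 5.6 (i)
  (chunk p0009). [cite: HertlingLarabi2026b, §5 Rem. 5.6 (i), chunk p0009]
-/

noncomputable section

open scoped Pointwise
open Module Function Submodule

open Literature.NumberTheory.Automorphic (IsFullLattice mem_units_smul_submodule_iff)
open Literature.LinearAlgebra.Matrix.LatimerMacDuffeeSquarefree (equivalence_exists_units_smul)

namespace Literature.NumberTheory.ComplexMultiplication.FiniteQAlgebraLattice

variable {A : Type} [CommRing A] [Algebra ℚ A]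

/-! ## §1 The `w`-class of an `ε`-class: the projection `[L]_ε ↦ [L]_w` -/

omit [Algebra ℚ A] in
/-- **`W(𝓛(A)) = W(𝓔(A))` over an order: the projection `[L]_ε ↦ [L]_w` from the `ε`-classes to the `w`-classes of
the exact `Λ`-ideals EXISTS (is well defined — `ε`-equivalent lattices are `w`-equivalent, Thm. 5.7 (c)), and any
map with `[L]_ε ↦ [L]_w` is SURJECTIVE.** [cite: HertlingLarabi2026, §5 Thm. 5.7 (c), chunk p0013] -/
theorem exists_quotMap_weak (Λ : Submodule ℤ A) :
    ∃ f : Quot (fun L L' : {L : Submodule ℤ A // IsFullLattice A L ∧ L / L = Λ} => ∃ u : Aˣ, u • L.1 = L'.1) →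
        Quot fun L L' : {L : Submodule ℤ A // IsFullLattice A L ∧ L / L = Λ} =>
          (1 : A) ∈ (L.1 / L'.1) * (L'.1 / L.1),
      (∀ L, f (Quot.mk _ L) = Quot.mk _ L) ∧ Surjective f := by
  refine ⟨Quot.lift (fun L => Quot.mk _ L) fun L L' h => Quot.sound ?_, fun L => rfl, ?_⟩
  · obtain ⟨u, hu⟩ := h
    exact one_mem_div_mul_div_of_units_smul_eq hu
  · rintro ⟨L⟩
    exact ⟨Quot.mk _ L, rfl⟩

/-- **The `w`-classes of exact `Λ`-ideals are FINITELY MANY** for every finite-dimensional commutative `ℚ`-algebra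
and every full lattice `Λ` («the finite set `{[L]_ε | L ∈ 𝓛(A), 𝒪(L) = Λ}` splits into finitely many
`w`-classes», HL26b Rem. 5.6 (i) ∕ HL 2026 Thm. 1.3 (b); a quotient of the finite set of Thm. 6.5).
[cite: HertlingLarabi2026, §1 Thm. 1.3 (b), chunk p0003] [cite: HertlingLarabi2026b, §5 Rem. 5.6 (i), chunk p0009] -/
theorem finite_quot_weak_div_self_eq [Module.Finite ℚ A] {Λ : Submodule ℤ A} (hΛ : IsFullLattice A Λ) :
    Finite (Quot fun L L' : {L : Submodule ℤ A // IsFullLattice A L ∧ L / L = Λ} =>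
      (1 : A) ∈ (L.1 / L'.1) * (L'.1 / L.1)) := by
  haveI := finite_quot_div_self_eq hΛ
  obtain ⟨f, -, hf⟩ := exists_quotMap_weak Λ
  exact Finite.of_surjective f hf

/-! ## §2 Each `w`-class of `ε`-classes over `Λ` has `|G([Λ]_ε)|` elements -/

omit [Algebra ℚ A] in
/-- **The fibre of `[L]_ε ↦ [L]_w` over `[L_1]_w` is `[[L_1]_ε]_w = {[L_2]_ε | L_2 ∼_w L_1}`** — in bijection (here:
same `Nat.card`) with the `ε`-classes of full `L_2` weakly equivalent to `L_1` (the condition `𝒪(L_2) = Λ` being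
automatic: `𝒪(L_1) = 𝒪(L_2)`, Thm. 5.7 (a)). [cite: HertlingLarabi2026, §5 Thm. 5.7 (a)(c), chunk p0013] -/
theorem natCard_fibre_eq_natCard_quot_weak {Λ : Submodule ℤ A}
    {f : Quot (fun L L' : {L : Submodule ℤ A // IsFullLattice A L ∧ L / L = Λ} => ∃ u : Aˣ, u • L.1 = L'.1) →
      Quot fun L L' : {L : Submodule ℤ A // IsFullLattice A L ∧ L / L = Λ} =>
        (1 : A) ∈ (L.1 / L'.1) * (L'.1 / L.1)}
    (hf : ∀ L, f (Quot.mk _ L) = Quot.mk _ L) (L₁ : {L : Submodule ℤ A // IsFullLattice A L ∧ L / L = Λ}) :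
    Nat.card {q // f q = Quot.mk _ L₁} =
      Nat.card (Quot fun L L' : {L₂ : Submodule ℤ A //
        IsFullLattice A L₂ ∧ (1 : A) ∈ (L₁.1 / L₂) * (L₂ / L₁.1)} => ∃ u : Aˣ, u • L.1 = L'.1) := by
  -- `ψ : [[L₁]_ε]_w → fibre`, `[L₂]_ε ↦ [L₂]_ε`
  have hO : ∀ L₂ : {L₂ : Submodule ℤ A // IsFullLattice A L₂ ∧ (1 : A) ∈ (L₁.1 / L₂) * (L₂ / L₁.1)},
      L₂.1 / L₂.1 = Λ := fun L₂ => (div_self_eq_div_self_of_one_mem L₂.2.2).symm.trans L₁.2.2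
  have hmem : ∀ L₂ : {L₂ : Submodule ℤ A // IsFullLattice A L₂ ∧ (1 : A) ∈ (L₁.1 / L₂) * (L₂ / L₁.1)},
      f (Quot.mk _ ⟨L₂.1, L₂.2.1, hO L₂⟩) = Quot.mk _ L₁ := fun L₂ => by
    rw [hf]
    exact Quot.sound ((one_mem_div_mul_div_comm _ _).1 L₂.2.2)
  refine (Nat.card_eq_of_bijective (Quot.lift (fun L₂ => (⟨Quot.mk _ ⟨L₂.1, L₂.2.1, hO L₂⟩, hmem L₂⟩ :
      {q // f q = Quot.mk _ L₁})) fun L₂ L₂' h => ?_) ⟨?_, ?_⟩).symm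
  · obtain ⟨u, hu⟩ := h
    exact Subtype.ext (Quot.sound ⟨u, hu⟩)
  · rintro ⟨L₂⟩ ⟨L₂'⟩ h
    have h' := congrArg Subtype.val h
    obtain ⟨u, hu⟩ := (equivalence_exists_units_smul _).eqvGen_iff.1 (Quot.eqvGen_exact h')
    exact Quot.sound ⟨u, hu⟩
  · rintro ⟨⟨L⟩, hL⟩
    rw [hf] at hL
    have hw : (1 : A) ∈ (L₁.1 / L.1) * (L.1 / L₁.1) :=
      (one_mem_div_mul_div_comm _ _).1
        ((equivalence_one_mem_div_mul_div _).eqvGen_iff.1 (Quot.eqvGen_exact hL))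
    exact ⟨Quot.mk _ ⟨L.1, L.2.1, hw⟩, rfl⟩

/-- **REMARKS 5.6 (i) ∕ THM. 1.3 (b): every `w`-class of `ε`-classes over `Λ` has the size of `G([Λ]_ε)`** («These
`w`-classes have all the same size, because (5.3) gives bijections from the finite group `G([Λ]_ε)` to any other
`w`-class in the finite set `{[L]_ε | L ∈ 𝓛(A), 𝒪(L) = Λ}`»; the bijection (5.13) is the tree's
`natCard_quot_invertible_eq_natCard_quot_weak`).
[cite: HertlingLarabi2026b, §5 Rem. 5.6 (i), chunk p0009] [cite: HertlingLarabi2026, §5 Thm. 5.8 (b) (5.13), chunk p0013] -/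
theorem natCard_fibre_eq_natCard_quot_invertible {Λ : Submodule ℤ A}
    {f : Quot (fun L L' : {L : Submodule ℤ A // IsFullLattice A L ∧ L / L = Λ} => ∃ u : Aˣ, u • L.1 = L'.1) →
      Quot fun L L' : {L : Submodule ℤ A // IsFullLattice A L ∧ L / L = Λ} =>
        (1 : A) ∈ (L.1 / L'.1) * (L'.1 / L.1)}
    (hf : ∀ L, f (Quot.mk _ L) = Quot.mk _ L) (L₁ : {L : Submodule ℤ A // IsFullLattice A L ∧ L / L = Λ}) :
    Nat.card {q // f q = Quot.mk _ L₁} =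
      Nat.card (Quot fun L L' : {L : Submodule ℤ A //
        IsFullLattice A L ∧ L / L = Λ ∧ L * ((L / L) / L) = L / L} => ∃ u : Aˣ, u • L.1 = L'.1) := by
  obtain ⟨L₁, hL₁, hO⟩ := L₁
  subst hO
  rw [natCard_fibre_eq_natCard_quot_weak hf, ← natCard_quot_invertible_eq_natCard_quot_weak hL₁]

/-! ## §3 THEOREM 1.3 (b): the counting formula -/

/-- **THEOREM 1.3 (b) (Hertling–Larabi 2026) ∕ REMARKS 5.6 (i) (2026b).** «For each order `Λ` the set
`{[L]_ε | L ∈ 𝓛(A), 𝒪(L) = Λ}` splits into finitely many `w`-classes, which have all the same (finite by part (a))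
size. One of them is the group `G([Λ]_ε)`.»  Counting form, for EVERY finite-dimensional commutative `ℚ`-algebra
`A` and every full lattice `Λ`:
**`#{[L]_ε | 𝒪(L) = Λ} = #{[L]_w | 𝒪(L) = Λ} · |G([Λ]_ε)|`** (all three finite: Thm. 6.5, §1, Rem. 9.3 (iii)).
[cite: HertlingLarabi2026, §1 Thm. 1.3 (b) and §5 Thm. 5.8 (b), chunks p0003, p0013]
[cite: HertlingLarabi2026b, §5 Rem. 5.6 (i), chunk p0009] -/
theorem natCard_quot_div_self_eq_eq_mul [Module.Finite ℚ A] {Λ : Submodule ℤ A} (hΛ : IsFullLattice A Λ) :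
    Nat.card (Quot fun L L' : {L : Submodule ℤ A // IsFullLattice A L ∧ L / L = Λ} =>
        ∃ u : Aˣ, u • L.1 = L'.1) =
      Nat.card (Quot fun L L' : {L : Submodule ℤ A // IsFullLattice A L ∧ L / L = Λ} =>
          (1 : A) ∈ (L.1 / L'.1) * (L'.1 / L.1)) *
        Nat.card (Quot fun L L' : {L : Submodule ℤ A //
          IsFullLattice A L ∧ L / L = Λ ∧ L * ((L / L) / L) = L / L} => ∃ u : Aˣ, u • L.1 = L'.1) := by
  classical
  haveI := finite_quot_div_self_eq hΛ
  haveI := finite_quot_invertible hΛ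
  obtain ⟨f, hf, -⟩ := exists_quotMap_weak Λ
  -- every fibre of `f` has `|G([Λ]_ε)|` elements
  have hfib : ∀ c, Nonempty ({q // f q = c} ≃ Quot fun L L' : {L : Submodule ℤ A //
      IsFullLattice A L ∧ L / L = Λ ∧ L * ((L / L) / L) = L / L} => ∃ u : Aˣ, u • L.1 = L'.1) := by
    rintro ⟨L₁⟩
    exact Finite.card_eq.1 (natCard_fibre_eq_natCard_quot_invertible hf L₁)
  have e := fun c => Classical.choice (hfib c)
  rw [← Nat.card_prod, ← Nat.card_congr (Equiv.sigmaFiberEquiv f),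
    Nat.card_congr ((Equiv.sigmaCongrRight e).trans (Equiv.sigmaEquivProd _ _))]

/-- **`|G([Λ]_ε)|` DIVIDES `#{[L]_ε | 𝒪(L) = Λ}`** (Thm. 1.3 (b): the `ε`-classes over `Λ` are a disjoint union of
`w`-classes of the size of the group `G([Λ]_ε)`, «One of them is the group `G([Λ]_ε)`»).
[cite: HertlingLarabi2026, §1 Thm. 1.3 (b), chunk p0003] -/
theorem natCard_quot_invertible_dvd_natCard_quot_div_self_eq [Module.Finite ℚ A] {Λ : Submodule ℤ A}
    (hΛ : IsFullLattice A Λ) :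
    Nat.card (Quot fun L L' : {L : Submodule ℤ A //
        IsFullLattice A L ∧ L / L = Λ ∧ L * ((L / L) / L) = L / L} => ∃ u : Aˣ, u • L.1 = L'.1) ∣
      Nat.card (Quot fun L L' : {L : Submodule ℤ A // IsFullLattice A L ∧ L / L = Λ} =>
        ∃ u : Aˣ, u • L.1 = L'.1) :=
  Dvd.intro_left _ (natCard_quot_div_self_eq_eq_mul hΛ).symm

/-- **The number of `w`-classes over `Λ` is at most the number of `ε`-classes over `Λ`** (both finite).
[cite: HertlingLarabi2026, §1 Thm. 1.3 (b), chunk p0003] -/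
theorem natCard_quot_weak_le_natCard_quot_div_self_eq [Module.Finite ℚ A] {Λ : Submodule ℤ A}
    (hΛ : IsFullLattice A Λ) :
    Nat.card (Quot fun L L' : {L : Submodule ℤ A // IsFullLattice A L ∧ L / L = Λ} =>
        (1 : A) ∈ (L.1 / L'.1) * (L'.1 / L.1)) ≤
      Nat.card (Quot fun L L' : {L : Submodule ℤ A // IsFullLattice A L ∧ L / L = Λ} =>
        ∃ u : Aˣ, u • L.1 = L'.1) := by
  haveI := finite_quot_div_self_eq hΛ
  obtain ⟨f, -, hf⟩ := exists_quotMap_weak Λ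
  exact Nat.card_le_card_of_surjective f hf

/-- **If `Λ` itself is the only order-`Λ` class up to `w`-equivalence — e.g. when every exact `Λ`-ideal is invertible
(`G(Λ) = [Λ]_w`, Thm. 5.8 (b) (5.11)) — then `#{[L]_ε | 𝒪(L) = Λ} = |G([Λ]_ε)|`**; in general the number of
`ε`-classes over `Λ` with exactly ONE `w`-class equals `|G([Λ]_ε)|`.
[cite: HertlingLarabi2026, §5 Thm. 5.8 (b) (5.11) and §1 Thm. 1.3 (b), chunks p0013, p0003] -/
theorem natCard_quot_div_self_eq_eq_of_natCard_quot_weak_eq_one [Module.Finite ℚ A] {Λ : Submodule ℤ A}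
    (hΛ : IsFullLattice A Λ)
    (h1 : Nat.card (Quot fun L L' : {L : Submodule ℤ A // IsFullLattice A L ∧ L / L = Λ} =>
        (1 : A) ∈ (L.1 / L'.1) * (L'.1 / L.1)) = 1) :
    Nat.card (Quot fun L L' : {L : Submodule ℤ A // IsFullLattice A L ∧ L / L = Λ} =>
        ∃ u : Aˣ, u • L.1 = L'.1) =
      Nat.card (Quot fun L L' : {L : Submodule ℤ A //
        IsFullLattice A L ∧ L / L = Λ ∧ L * ((L / L) / L) = L / L} => ∃ u : Aˣ, u • L.1 = L'.1) := by
  rw [natCard_quot_div_self_eq_eq_mul hΛ, h1, one_mul]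

end Literature.NumberTheory.ComplexMultiplication.FiniteQAlgebraLattice
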